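import Summits.BirchSwinnertonDyer.Rank1Residual.JET.HeegnerE0ReceptacleByName
import HarnessLib

/-!
# (P2) PILOT — the walk's E⁰-RECEPTACLE input for a LABELLED CM FAMILY on `X_{N⁺,N⁻}` from the label (B6)
# «the CM points lie in `E⁰` up to rational torsion above a split bad prime `q`» (cell `bsd-stepL`, seat
# `bsd-stepL-tam3-p1` g12, owner of 19109's line; `--supports stmt-BirchSwinnertonDyer-19109 --as helper`)

HONEST FRAMING: THEOREMS ONLY (no definition, no named fact, no `sorry`). Nothing here constructs a CM point, proves the
label (B6), or touches `Ш`; item 19109 is NOT closed; no census number moves (T7). BSD is not proved by any of this.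

WHAT. The Jetchev walk of 19109's line (tam3-p1 g5–g10, `…EulerHalvesAtThreeWalk*`, over cell bsd-jet's road K) consumes
the identity component through ONE binder shape, the receptacle form `hGZ′`: «`n' • (γ y_m)_v ∈ X11b.E0Receptacle (W⁄K) v`
(and the same for `y_{m/ℓ}` read in `K[m]`) at the bad places `v`, with `IsCoprime p n'`» — supplied for the `X₀(N)` datum
`KolyvaginHeegnerData` by `JET.hGZ_of_Gross1991` from the Literature fact `Gross1991_heegnerPoint_sub_ratTorsion_mem_E0`
([GZ86 III (3.1)]) under the FULL Heegner hypothesis and `ρ̄_{E,p}` onto. The port of the walk to the Shimura curve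
(PORT-SPEC (P2), HOME/corner3/g6/PORT-SPEC.md; PORT MAP HOME/tam3-p1/skeleton-19109-g12/PORT-MAP-P2-g12.md §2 (iii)) needs
the same binder for a BARE family `ys : (m : ℕ) → E(K[m])` from the Summits-side label (B6) of lit g32's sketch
`ShimuraCMFamily.LabelB6` (at a place `w` of `K[m]` above `q`: `ys m − t ∈ E₀(K[m])_w` for a rational torsion `t`), at a
prime `q ∣ N` that SPLITS in `K` (the carrier `q₁ ∉ S` of the inert road; no Heegner hypothesis on `N`), for IRREDUCIBLE
`E[p]` (image-free: serves the `Surj` slice of 19109 and the corner 21420 alike). This file is that pilot: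
* `natCast_mem_and_isMinimal_of_split` — at a place `v` of `K` over a prime `q ∣ N` with
  `#((q).primesOver 𝓞_K) = 2`: `N ∈ v` and `(W⁄K) ⊗ K_v` is a minimal equation (twin of
  `JET.conductorNorm_mem_and_isMinimal_of_not_hasGoodReductionAt`, keyed on ONE split prime instead of the Heegner
  hypothesis; `carrierRowData_of_split`);
* `torsionOrder_zsmul_pointsMap_map_mem_E0Receptacle` — transport with a torsion translate: for ANY number field `L`,
  `ℚ`-embedding `e : L → K̄`, point `P ∈ E(L)` with `P − t_w ∈ E₀(L)_w` (`t_w ∈ E(ℚ)` torsion) at every place `w` of `L`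
  above `q`, and `v` over `q` with `(W⁄K) ⊗ K_v` minimal: `#E(ℚ)_tors • (e P)_v ∈ E0Receptacle (W⁄K) v`
  (`JET.pointsMap_map_mem_E0Receptacle_of_forall_place` + `hasNonsingularReduction_placeIntModel_nsmul`);
* `isCoprime_torsionOrder_of_irr` — `p ∤ #E(ℚ)_tors` for irreducible `E[p]`;
* `receptacle_of_labelB6` (HEADLINE) — the `hGZ′`-shaped binder for the labelled family at every place of `K` over `q`:
  both clauses (level `m`, and any included level `m' ≤ m` read in `K[m]`), every `γ ∈ Aut_ℚ(K[m])`, every `ℚ`-embedding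
  `K[m] → K̄`, witness `n' = #E(ℚ)_tors`.
WHY IT MATTERS (PORT MAP §1): at an ADDITIVE carrier (`q₁ = 2`, Kodaira IV∕IV*, the only case consumed on the 178 residual
frames) `E⁰(K[n]_w)` is uniquely 3-divisible, so this receptacle statement is exactly what makes the depth-`k` classes
STRICT at `w` (Jetchev's input); (DIV) ⟺ (B6)-on-derived-points modulo the walk.

References: [cite: GrossLMS1991, §6, proof of Prop. 6.2 (1), p. 245] [cite: GrossZagier1986Heegner, III (3.1)]
[cite: SilvermanAEC2009, VII.1 Prop. 1.3 (b), VII.2 Prop. 2.1] [cite: Zhang2001Heights, §4.4, proof of Prop. 4.4.2, Case 2]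
[cite: Kim2022HigherGZ, Rem. 7.9] [cite: CasselsFrohlichANT1967, Ch. II §10].
presearch: «CM points of X_{N⁺,N⁻} reduce into the identity component at split level primes» → lit g32 sheet L63 (Zhang 2001
§4.4 Case 2 = printed ingredient; sentence not in print); tree `lean search 'E0Receptacle_of|hGZ_of'` → JET's X₀(N) supplies only.
-/

set_option autoImplicit false
set_option linter.dupNamespace false

noncomputable section

open scoped Classical Pointwise

open WeierstrassCurve IsDedekindDomain NumberField Field Literature.NumberTheory.EllipticCurves
  Literature.NumberTheory.EllipticCurves.ModularForms
  Literature.NumberTheory.GaloisRepresentations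
  Summit.BirchSwinnertonDyer.Rank1Residual.X11b Literature.NumberTheory.Automorphic
  Summit.BirchSwinnertonDyer.Rank1Residual.JET

namespace Summit.BirchSwinnertonDyer.BirchSwinnertonDyer.Theorems.ShimuraKolyvaginOfImage

/-! ### §1 A split bad prime: `N ∈ v` and minimality of `W ⊗ K_v` -/

/-- **At a place `v` of `K` over a prime `q ∣ N` that splits in `K`: `N ∈ v` and `(W⁄K) ⊗ K_v` is a minimal equation.**
`K` imaginary quadratic, `#((q)·𝓞_K).primesOver = 2` (so `Gal(K/ℚ) = {1, τ}` moves `v`, `K_v = ℚ_q`, and the globally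
minimal `W ⊗ ℚ_q` stays minimal over `𝓞_v`, bsd-jet's `carrierRowData_of_split`). Twin of
`JET.conductorNorm_mem_and_isMinimal_of_not_hasGoodReductionAt` keyed on ONE split prime.
[cite: SilvermanAEC2009, VII.1 Prop. 1.3 (b)] [cite: CasselsFrohlichANT1967, Ch. II §10, Ch. VII Prop. 1.2 (ii)] -/
theorem natCast_mem_and_isMinimal_of_split (W : WeierstrassCurve ℚ) [W.IsElliptic] [W.IsGloballyMinimal]
    {K : Type} [Field K] [NumberField K] (hK : IsImaginaryQuadratic K)
    (q : ℕ) [Fact q.Prime] (hq2 : ((Ideal.span {(q : ℤ)}).primesOver (𝓞 K)).ncard = 2)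
    {N : ℕ} (hqN : q ∣ N) (v : HeightOneSpectrum (𝓞 K)) (hqv : ((q : ℕ) : 𝓞 K) ∈ v.asIdeal) :
    ((N : ℕ) : 𝓞 K) ∈ v.asIdeal ∧
      ((W.baseChange K).baseChange (v.adicCompletion K)).IsMinimal (v.adicCompletionIntegers K) := by
  have hq : q.Prime := Fact.out
  have hNv : ((N : ℕ) : 𝓞 K) ∈ v.asIdeal := by
    obtain ⟨c, hc⟩ := hqN
    rw [hc, Nat.cast_mul]
    exact v.asIdeal.mul_mem_right _ hqv
  refine ⟨hNv, ?_⟩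
  -- the single-prime Heegner hypothesis at `q`
  have hH : SatisfiesHeegnerHypothesis q K := by
    intro r hr hrq
    rw [(Nat.prime_dvd_prime_iff_eq hr hq).mp hrq]
    exact hq2
  -- `Gal(K/ℚ) = {1, τ}`
  haveI : Algebra.IsQuadraticExtension ℚ K := ⟨hK.1⟩
  have hcard : Nat.card (K ≃ₐ[ℚ] K) = 2 := by rw [IsGalois.card_aut_eq_finrank, hK.1]
  obtain ⟨τ, hτ, huniq⟩ := (Nat.card_eq_two_iff' (1 : K ≃ₐ[ℚ] K)).mp hcard
  have hτ2 : τ * τ = 1 := by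
    rw [mul_eq_one_iff_eq_inv]
    exact (huniq τ⁻¹ (inv_ne_one.mpr hτ)).symm
  -- a place `v₀ ∣ q` with `τ • v₀ ≠ v₀`; `v` is `v₀` or `τ • v₀`
  obtain ⟨v₀, hv₀, -, hqv₀⟩ := exists_split_place_of_dvd K hK τ hτ hH q (dvd_refl q)
  obtain ⟨σ, hσ⟩ := HeightOneSpectrum.exists_algEquiv_smul_eq (F := ℚ) (w := v₀) (w' := v)
    (LocalField.heightOneSpectrum_rat_eq_of_natCast_mem q _ _
      (LocalField.natCast_mem_under q v₀ hqv₀) (LocalField.natCast_mem_under q v hqv))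
  have hτv : τ • v ≠ v := by
    by_cases hσ1 : σ = 1
    · subst hσ1
      rw [one_smul] at hσ
      subst hσ
      exact hv₀
    · have hστ : σ = τ := huniq σ hσ1
      subst hστ
      subst hσ
      rw [smul_smul, hτ2, one_smul]
      exact fun h ↦ hv₀ h.symm
  obtain ⟨hmin, -, -, -, -⟩ := carrierRowData_of_split W K q hK τ v hτv hqv
  exact hmin

/-! ### §2 Transport with a torsion translate -/

/-- **`#E(ℚ)_tors • (e P)_v ∈ E⁰(K̄_v)` when `P ∈ E(L)` lies in `E₀(L)_w` up to rational torsion at every place `w` of `L`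
above `q ∈ v`.** For `W/ℚ` globally minimal, a finite place `v` of the number field `K` with `(W⁄K) ⊗ K_v` minimal and a
prime `q ∈ v`, a number field `L` with a `ℚ`-embedding `e : L → K̄`, and `P ∈ E(L)` such that at every place `w` of `L`
containing `q` there is a torsion `t ∈ E(ℚ)` with `P − t ∈ E₀(L)_w` (nonsingular reduction on `W`): the multiple
`#E(ℚ)_tors • P` has nonsingular reduction at every such `w` (`E₀ ∩ E(L)` is a group, Silverman VII.2.1;
`#E(ℚ)_tors • t = O`), so its image in `E(K̄_v)` lies in the receptacle (JET's transport
`pointsMap_map_mem_E0Receptacle_of_forall_place`). [cite: SilvermanAEC2009, VII.2 Prop. 2.1, VII.1 Prop. 1.3 (b)]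
[cite: GrossLMS1991, §6, proof of Prop. 6.2 (1), p. 245] -/
theorem torsionOrder_zsmul_pointsMap_map_mem_E0Receptacle (W : WeierstrassCurve ℚ) [W.IsElliptic]
    [W.IsGloballyMinimal] {K : Type} [Field K] [NumberField K] (v : HeightOneSpectrum (𝓞 K))
    (hmin : ((W.baseChange K).baseChange (v.adicCompletion K)).IsMinimal (v.adicCompletionIntegers K))
    (q : ℕ) (hqv : ((q : ℕ) : 𝓞 K) ∈ v.asIdeal) {L : Type} [Field L] [NumberField L] [DecidableEq L]
    (e : L →ₐ[ℚ] AlgebraicClosure K) (P : (W.baseChange L).toAffine.Point)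
    (hP : ∀ w : HeightOneSpectrum (𝓞 L), ((q : ℕ) : 𝓞 L) ∈ w.asIdeal →
      ∃ t : W.toAffine.Point, IsOfFinAddOrder t ∧
        (placeIntModel W L w).HasNonsingularReduction (K := L) (P - W.pointToBaseChange L t)) :
    (W.torsionOrder : ℤ) • pointsMap (W.baseChange K) (v.adicCompletion K) (Affine.Point.map (W' := W) e P) ∈
      E0Receptacle (W.baseChange K) v := by
  have htors : ∀ t : W.toAffine.Point, IsOfFinAddOrder t → W.torsionOrder • t = 0 := fun t ht ↦
    addOrderOf_dvd_iff_nsmul_eq_zero.mp (addOrderOf_dvd_torsionOrder W ht)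
  have hE0 : ∀ w : HeightOneSpectrum (𝓞 L), ((q : ℕ) : 𝓞 L) ∈ w.asIdeal →
      (placeIntModel W L w).HasNonsingularReduction (K := L) (W.torsionOrder • P) := by
    intro w hw
    obtain ⟨t, ht, hmem⟩ := hP w hw
    have hpt : W.pointToBaseChange L (W.torsionOrder • t) = W.torsionOrder • W.pointToBaseChange L t := by
      rw [pointToBaseChange_eq_map, pointToBaseChange_eq_map]
      exact map_nsmul (Affine.Point.map (W' := W) (F := ℚ) (Algebra.ofId ℚ L)) W.torsionOrder t
    have h0 : W.pointToBaseChange L 0 = 0 := by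
      rw [pointToBaseChange_eq_map]
      exact map_zero _
    have heq : W.torsionOrder • (P - W.pointToBaseChange L t) = W.torsionOrder • P := by
      rw [nsmul_sub, ← hpt, htors t ht, h0, sub_zero]
    exact heq ▸ Gross1991_heegnerPoint_sub_ratTorsion_mem_E0.hasNonsingularReduction_placeIntModel_nsmul L w hmem _
  have key := pointsMap_map_mem_E0Receptacle_of_forall_place W v hmin hqv e (W.torsionOrder • P) hE0
  have h1 : Affine.Point.map (W' := W) e (W.torsionOrder • P) = W.torsionOrder • Affine.Point.map (W' := W) e P :=
    map_nsmul _ _ _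
  have h2 : pointsMap (W.baseChange K) (v.adicCompletion K) (W.torsionOrder • Affine.Point.map (W' := W) e P) =
      W.torsionOrder • pointsMap (W.baseChange K) (v.adicCompletion K) (Affine.Point.map (W' := W) e P) :=
    map_nsmul _ _ _
  rw [h1, h2] at key
  rw [natCast_zsmul]
  exact key

/-- **`p ∤ #E(ℚ)_tors` for irreducible `E[p]`** (a rational point of order `p` spans a `Γ_ℚ`-stable line).
[cite: SilvermanAEC2009, III.8] -/
theorem isCoprime_torsionOrder_of_irr (W : WeierstrassCurve ℚ) [W.IsElliptic] (p : ℕ) [Fact p.Prime]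
    (hirr : W.HasIrreducibleModPGaloisRep p) : IsCoprime (p : ℤ) (W.torsionOrder : ℤ) := by
  have hp : p.Prime := Fact.out
  exact Nat.isCoprime_iff_coprime.mpr ((Nat.Prime.coprime_iff_not_dvd hp).mpr fun h ↦
    not_hasIrreducibleModPGaloisRep_of_dvd_torsionOrder W p h hirr)

/-! ### §3 The `hGZ′`-shaped receptacle binder for a labelled CM family -/

/-- **The walk's receptacle input from the label (B6), for a BARE family on `X_{N⁺,N⁻}`.** `W/ℚ` globally minimal with
`E[p]` irreducible, `K` imaginary quadratic, `ι : K → ℂ`, `K[m] = ringClassField K ι m`, a family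
`ys m ∈ E(K[m])`, a prime `q ∣ N` that SPLITS in `K`, and the label (B6) at `q` (lit g32's `LabelB6` shape, guarded as
printed: square-free `m` with prime factors `∤ N` and inert in `K`; at every place `w` of `K[m]` above `q`,
`ys m − t ∈ E₀(K[m])_w` for some rational torsion `t`). THEN `n' := #E(ℚ)_tors` is prime to `p` and, for every such `m`,
every `ℚ`-embedding `e : K[m] → K̄`, every `γ ∈ Aut_ℚ(K[m])` and every place `v` of `K` above `q`:
`n' • (e (γ • ys m))_v ∈ E0Receptacle (W⁄K) v`, and the same for `ys m'` at every labelled level `m'` with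
`K[m'] ≤ K[m]`, read in `K[m]`. This is the shape of bsd-jet's `hGZ'` (`JET.hGZ_of_Gross1991`, the `X₀(N)` datum) at the
places over `q` — the family-side input §2 (iii) of the PORT MAP. CONDITIONAL on the label; nothing is asserted about any
CM point. [cite: GrossLMS1991, §6, proof of Prop. 6.2 (1), p. 245] [cite: GrossZagier1986Heegner, III (3.1)]
[cite: Zhang2001Heights, §4.4, proof of Prop. 4.4.2, Case 2] [cite: Kim2022HigherGZ, Rem. 7.9] -/
theorem receptacle_of_labelB6 (W : WeierstrassCurve ℚ) [W.IsElliptic] [W.IsGloballyMinimal]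
    {K : Type} [Field K] [NumberField K] (hK : IsImaginaryQuadratic K) (ι : K →+* ℂ)
    (p : ℕ) [Fact p.Prime] (hirr : W.HasIrreducibleModPGaloisRep p)
    {N : ℕ} (q : ℕ) [Fact q.Prime] (hqN : q ∣ N) (hq2 : ((Ideal.span {(q : ℤ)}).primesOver (𝓞 K)).ncard = 2)
    [∀ j : ℕ, NumberField (ringClassField K ι j)]
    (ys : (m : ℕ) → (W.baseChange (ringClassField K ι m)).toAffine.Point)
    (hB6 : ∀ m : ℕ, Squarefree m → (∀ r ∈ m.primeFactors, ¬ r ∣ N ∧ (Ideal.span {(r : 𝓞 K)}).IsPrime) →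
      ∀ w : HeightOneSpectrum (𝓞 (ringClassField K ι m)), ((q : ℕ) : 𝓞 (ringClassField K ι m)) ∈ w.asIdeal →
        ∃ t : W.toAffine.Point, IsOfFinAddOrder t ∧
          (placeIntModel W (ringClassField K ι m) w).HasNonsingularReduction (K := ringClassField K ι m)
            (ys m - W.pointToBaseChange (ringClassField K ι m) t)) :
    IsCoprime (p : ℤ) (W.torsionOrder : ℤ) ∧
      ∀ (m : ℕ), Squarefree m → (∀ r ∈ m.primeFactors, ¬ r ∣ N ∧ (Ideal.span {(r : 𝓞 K)}).IsPrime) →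
        ∀ (e : ringClassField K ι m →ₐ[ℚ] AlgebraicClosure K)
          (γ : ringClassField K ι m ≃ₐ[ℚ] ringClassField K ι m)
          (v : HeightOneSpectrum (𝓞 K)), ((q : ℕ) : 𝓞 K) ∈ v.asIdeal →
          (W.torsionOrder : ℤ) • pointsMap (W.baseChange K) (v.adicCompletion K)
              (Affine.Point.map (W' := W) e (pointGalHom W (ringClassField K ι m) γ (ys m))) ∈
            E0Receptacle (W.baseChange K) v ∧
          ∀ (m' : ℕ), Squarefree m' → (∀ r ∈ m'.primeFactors, ¬ r ∣ N ∧ (Ideal.span {(r : 𝓞 K)}).IsPrime) →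
            ∀ (hle : ringClassField K ι m' ≤ ringClassField K ι m),
            (W.torsionOrder : ℤ) • pointsMap (W.baseChange K) (v.adicCompletion K)
                (Affine.Point.map (W' := W) e (pointGalHom W (ringClassField K ι m) γ
                  (WeierstrassCurve.Affine.Point.map (W' := W)
                    ((RingClassField.inclusion ι hle).restrictScalars ℚ) (ys m')))) ∈
              E0Receptacle (W.baseChange K) v := by
  refine ⟨isCoprime_torsionOrder_of_irr W p hirr, ?_⟩
  intro m hm hguard e γ v hqv
  obtain ⟨-, hmin⟩ := natCast_mem_and_isMinimal_of_split W hK q hq2 hqN v hqv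
  refine ⟨?_, fun m' hm' hguard' hle ↦ ?_⟩
  · -- level `m`
    rw [pointGalHom_apply]
    change (W.torsionOrder : ℤ) • pointsMap (W.baseChange K) (v.adicCompletion K)
      (Affine.Point.map (W' := W) e
        (Affine.Point.map (W' := W) (γ : ringClassField K ι m →ₐ[ℚ] ringClassField K ι m) (ys m))) ∈ _
    rw [Affine.Point.map_map]
    exact torsionOrder_zsmul_pointsMap_map_mem_E0Receptacle W v hmin q hqv _ (ys m) (hB6 m hm hguard)
  · -- level `m'` read in `K[m]`
    rw [pointGalHom_apply]
    change (W.torsionOrder : ℤ) • pointsMap (W.baseChange K) (v.adicCompletion K)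
      (Affine.Point.map (W' := W) e
        (Affine.Point.map (W' := W) (γ : ringClassField K ι m →ₐ[ℚ] ringClassField K ι m)
          (Affine.Point.map (W' := W) ((RingClassField.inclusion ι hle).restrictScalars ℚ) (ys m')))) ∈ _
    rw [Affine.Point.map_map, Affine.Point.map_map]
    exact torsionOrder_zsmul_pointsMap_map_mem_E0Receptacle W v hmin q hqv _ (ys m') (hB6 m' hm' hguard')

end Summit.BirchSwinnertonDyer.BirchSwinnertonDyer.Theorems.ShimuraKolyvaginOfImage

end
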